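import Literature.MathematicalPhysics.QuantumFieldTheory.Balaban1983to89.Beta.OddMoments

/-!
# `BalabanUV.Gaps.D1ParityOddWitness` — cell pub-balaban-gaps, row (D1), seat g1-p1: THE REDUCTION OF THE END's REFLECTION BINDER TO FOUR PARITY-ODD FIRST MOMENTS IS SHARP —
# an explicit finitely supported kernel on `ℤ⁴` that is Ward-transversal (5.9) AND index-symmetric (5.8), with every moment summable, whose parity-odd first moment
# `m₁(0,1,2) = Σ_z P₀₁(z) z₂` equals `8 ≠ 0`

HONEST FRAMING (cell rule, page 1 of everything): [folklore] — an elementary lattice construction (the lattice form of the parity-odd gauge-invariant quadratic form `ε^{3μγν} A_μ ∂_γ A_ν`,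
smeared so that the BACKWARD-difference Ward identity of `PolarizationSign.WardTransversal` holds EXACTLY on `ℤ⁴`), plus finite bookkeeping of signed lattice deltas decided by `decide`.
It concerns an ABSTRACT kernel, NOT any object of Bałaban's and NOT the cells' literals: it shows that the printed laws (5.9) + (5.8) (+ summability of all moments) do NOT imply the
first-moment law (T1) the drift socket consumes — so in the companion file `Gaps/D1ParityOddFirstMoments` (seat g1-p1 GEN 15) the residual hypothesis «the four increasing
parity-odd first moments vanish» that replaces the END's `hR` CANNOT be dropped on symmetry bookkeeping alone (an1's `Beta.OddMoments` says so in prose: «for d ≥ 3 the out-of-plane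
odd moments are NOT killed by gauge invariance alone»; this file is the kernel-checked witness).  Nothing of Bałaban's asserted; NO coefficient of any cell literal computed or signed;
(D1) NOT discharged; 0∕4 row-D1 binders; NOT `BetaPertH`, NOT continuum, NOT Clay.

CONTENT (all [folklore]; 0 sorry; the `def`s are DATA — a lattice-vector encoding and the witness kernel — no `Prop` is defined):
§1 signed delta combinations `Σ_{(w,c) ∈ L} c·[z = w]` over a list `L` of (offset, integer coefficient): evaluation on ∕ off the offsets, vanishing when every offset's coefficients
sum to zero («balanced», decidable), shift and reflection of offsets, finite support ⟹ `MomentSummable`, the pairing `Σ'_z (Σ c·[z = w]) f(z) = Σ c·f(w)`;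
§2 the witness `csKernel : B12Beta.Kernel 4` (data: `toVec`, `eT`, `entries8`, `kerList`, `shiftNeg`, `wardList`, `swapList`): `csKernel μ ν = ε_{3μγν} (1 + T₋ₑμ)(1 + Tₑν)(T₋ₑγ − Tₑγ) δ₀` written as eight signed deltas;
§3 **`wardTransversal_csKernel`**, **`indexSymmetric_csKernel`**, `momentSummable_csKernel`, **`firstMoment_csKernel_012 : firstMoment csKernel 0 1 2 = 8`**;
§4 the sharpness statements: `not_firstMoments_vanish_csKernel`, `not_oddFree_csKernel` (the reduced hypothesis of the companion file FAILS for this kernel),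
`not_axisReflectionCovariant_csKernel` ((5.7) fails — consistent with an1's reflection route), **`exists_ward_indexSymmetric_not_T1`** (∃ a kernel on `ℤ⁴` with (5.9), (5.8), all
moments summable, and a nonzero first moment).

Provenance: cell pub-balaban-gaps, seat g1-p1 GEN 15 (prover-pub-balaban-gaps-g1-p1-g15-0), 2026-08-25; imports `Beta/OddMoments` only; no existing file touched.
-/

noncomputable section

open Literature.MathematicalPhysics.QuantumFieldTheory Balaban1983to89 Balaban1983to89.Beta
open PolarizationSign (IndexSymmetric WardTransversal AxisReflectionCovariant MomentSummable size)
open OddMoments (firstMoment firstMoment_eq_zero_of_reflectionCovariant)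
open B6BondElimination (unitVec unitVec_apply)

namespace Summit.QuantumFields.BalabanUV.Gaps.D1ParityOddWitness

/-! ## §1 Signed combinations of lattice deltas over a list of (offset, coefficient) -/

section Deltas

variable {d : ℕ}

/-- [folklore] Evaluation AT an offset-free point: if `z` is none of the offsets, `Σ_{(w,c)∈L} c·[z = w] = 0`. -/
theorem deltaSum_eq_zero_of_forall_ne (L : List ((Fin d → ℤ) × ℤ)) (z : Fin d → ℤ) (hz : ∀ p ∈ L, z ≠ p.1) :
    (L.map fun p => if z = p.1 then (p.2 : ℝ) else 0).sum = 0 := by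
  induction L with
  | nil => simp
  | cons q L ih =>
    rw [List.map_cons, List.sum_cons, if_neg (hz q (by simp)), zero_add]
    exact ih fun p hp => hz p (by simp [hp])

/-- [folklore] Evaluation in general: `Σ_{(w,c)∈L} c·[z = w]` is the (cast of the) sum of the coefficients of the entries with offset `z`. -/
theorem deltaSum_eq_filter (L : List ((Fin d → ℤ) × ℤ)) (z : Fin d → ℤ) :
    (L.map fun p => if z = p.1 then (p.2 : ℝ) else 0).sum = ((((L.filter fun q => decide (q.1 = z)).map Prod.snd).sum : ℤ) : ℝ) := by
  induction L with
  | nil => simp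
  | cons q L ih =>
    rw [List.map_cons, List.sum_cons, ih, List.filter_cons]
    by_cases h : z = q.1
    · have hq : decide (q.1 = z) = true := by rw [decide_eq_true_eq]; exact h.symm
      rw [if_pos h, if_pos hq, List.map_cons, List.sum_cons, Int.cast_add]
    · have hq : ¬ (decide (q.1 = z) = true) := by rw [decide_eq_true_eq]; exact fun e => h e.symm
      rw [if_neg h, if_neg hq, zero_add]

/-- [folklore] **A BALANCED combination vanishes identically**: if for every entry the coefficients of all entries sharing its offset sum to zero, then `Σ_{(w,c)∈L} c·[z = w] = 0` for
EVERY lattice point `z` (the hypothesis is decidable on explicit lists). -/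
theorem deltaSum_eq_zero_of_balanced (L : List ((Fin d → ℤ) × ℤ)) (hbal : ∀ p ∈ L, ((L.filter fun q => decide (q.1 = p.1)).map Prod.snd).sum = 0)
    (z : Fin d → ℤ) : (L.map fun p => if z = p.1 then (p.2 : ℝ) else 0).sum = 0 := by
  by_cases h : ∃ p ∈ L, z = p.1
  · obtain ⟨p, hp, rfl⟩ := h
    rw [deltaSum_eq_filter, hbal p hp, Int.cast_zero]
  · push Not at h
    exact deltaSum_eq_zero_of_forall_ne L z h

/-- [folklore] SHIFT of the evaluation point = shift of the offsets: `Σ c·[z − v = w] = Σ c·[z = w + v]`. -/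
theorem deltaSum_shift (L : List ((Fin d → ℤ) × ℤ)) (z v : Fin d → ℤ) :
    (L.map fun p => if z - v = p.1 then (p.2 : ℝ) else 0).sum = ((L.map fun p => (p.1 + v, p.2)).map fun p => if z = p.1 then (p.2 : ℝ) else 0).sum := by
  rw [List.map_map]
  congr 1
  refine List.map_congr_left fun p _ => ?_
  simp only [Function.comp_apply, sub_eq_iff_eq_add]

/-- [folklore] REFLECTION of the evaluation point = reflection of the offsets: `Σ c·[−z = w] = Σ c·[z = −w]`. -/
theorem deltaSum_neg (L : List ((Fin d → ℤ) × ℤ)) (z : Fin d → ℤ) :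
    (L.map fun p => if -z = p.1 then (p.2 : ℝ) else 0).sum = ((L.map fun p => (-p.1, p.2)).map fun p => if z = p.1 then (p.2 : ℝ) else 0).sum := by
  rw [List.map_map]
  congr 1
  refine List.map_congr_left fun p _ => ?_
  simp only [Function.comp_apply, neg_eq_iff_eq_neg]

/-- [folklore] NEGATION of the coefficients. -/
theorem deltaSum_negCoeff (L : List ((Fin d → ℤ) × ℤ)) (z : Fin d → ℤ) :
    ((L.map fun p => (p.1, -p.2)).map fun p => if z = p.1 then (p.2 : ℝ) else 0).sum = -(L.map fun p => if z = p.1 then (p.2 : ℝ) else 0).sum := by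
  induction L with
  | nil => simp
  | cons q L ih =>
    simp only [List.map_cons, List.sum_cons] at ih ⊢
    rw [ih]
    split_ifs <;> push_cast <;> ring

/-- [folklore] APPEND = addition. -/
theorem deltaSum_append (L L' : List ((Fin d → ℤ) × ℤ)) (z : Fin d → ℤ) :
    ((L ++ L').map fun p => if z = p.1 then (p.2 : ℝ) else 0).sum =
      (L.map fun p => if z = p.1 then (p.2 : ℝ) else 0).sum + (L'.map fun p => if z = p.1 then (p.2 : ℝ) else 0).sum := by
  rw [List.map_append, List.sum_append]

/-- [folklore] FINITE SUPPORT ⟹ every polynomial moment is summable: `Σ_z |Σ c·[z = w]| · size(z)^n < ∞`. -/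
theorem summable_abs_deltaSum_mul (L : List ((Fin d → ℤ) × ℤ)) (n : ℕ) :
    Summable fun z : Fin d → ℤ => |(L.map fun p => if z = p.1 then (p.2 : ℝ) else 0).sum| * size z ^ n := by
  refine summable_of_ne_finset_zero (s := (L.map Prod.fst).toFinset) fun z hz => ?_
  rw [deltaSum_eq_zero_of_forall_ne L z fun p hp h => hz (by rw [List.mem_toFinset, List.mem_map]; exact ⟨p, hp, h.symm⟩), abs_zero, zero_mul]

/-- [folklore] THE PAIRING WITH A WEIGHT: `Σ'_z (Σ_{(w,c)∈L} c·[z = w]) · f(z) = Σ_{(w,c)∈L} c · f(w)`. -/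
theorem tsum_deltaSum_mul (L : List ((Fin d → ℤ) × ℤ)) (f : (Fin d → ℤ) → ℝ) :
    ∑' z : Fin d → ℤ, (L.map fun p => if z = p.1 then (p.2 : ℝ) else 0).sum * f z = (L.map fun p => (p.2 : ℝ) * f p.1).sum := by
  induction L with
  | nil => simp
  | cons q L ih =>
    have hq : Summable fun z : Fin d → ℤ => (if z = q.1 then (q.2 : ℝ) else 0) * f z :=
      summable_of_ne_finset_zero (s := {q.1}) fun z hz => by rw [if_neg (by simpa using hz), zero_mul]
    have hL : Summable fun z : Fin d → ℤ => (L.map fun p => if z = p.1 then (p.2 : ℝ) else 0).sum * f z :=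
      summable_of_ne_finset_zero (s := (L.map Prod.fst).toFinset) fun z hz => by
        rw [deltaSum_eq_zero_of_forall_ne L z fun p hp h => hz (by rw [List.mem_toFinset, List.mem_map]; exact ⟨p, hp, h.symm⟩), zero_mul]
    calc ∑' z : Fin d → ℤ, ((q :: L).map fun p => if z = p.1 then (p.2 : ℝ) else 0).sum * f z
        = ∑' z : Fin d → ℤ, ((if z = q.1 then (q.2 : ℝ) else 0) * f z + (L.map fun p => if z = p.1 then (p.2 : ℝ) else 0).sum * f z) :=
          tsum_congr fun z => by simp only [List.map_cons, List.sum_cons]; ring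
      _ = ∑' z : Fin d → ℤ, (if z = q.1 then (q.2 : ℝ) else 0) * f z + ∑' z : Fin d → ℤ, (L.map fun p => if z = p.1 then (p.2 : ℝ) else 0).sum * f z :=
          hq.tsum_add hL
      _ = (q.2 : ℝ) * f q.1 + (L.map fun p => (p.2 : ℝ) * f p.1).sum := by
          rw [ih, tsum_eq_single q.1 (fun z hz => by rw [if_neg hz, zero_mul]), if_pos rfl]
      _ = ((q :: L).map fun p => (p.2 : ℝ) * f p.1).sum := by simp only [List.map_cons, List.sum_cons]

end Deltas

/-! ## §2 The witness kernel on `ℤ⁴` -/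

/-- [folklore] DATA: a lattice vector of `ℤ⁴` from an integer quadruple (computable encoding used by the `decide` bookkeeping). -/
def toVec (t : ℤ × ℤ × ℤ × ℤ) : Fin 4 → ℤ := fun i => if i = 0 then t.1 else if i = 1 then t.2.1 else if i = 2 then t.2.2.1 else t.2.2.2

/-- [folklore] DATA: the unit quadruples `e_μ`. -/
def eT (μ : Fin 4) : ℤ × ℤ × ℤ × ℤ := (if μ = 0 then 1 else 0, if μ = 1 then 1 else 0, if μ = 2 then 1 else 0, if μ = 3 then 1 else 0)

/-- [folklore] DATA: the eight signed offsets of `s · (1 + T₋ₑμ)(1 + Tₑν)(T₋ₑγ − Tₑγ) δ₀` read as `Σ c·[z = w]` (a delta `δ₀(z + v)` has offset `w = −v`). -/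
def entries8 (μ ν γ : Fin 4) (s : ℤ) : List ((ℤ × ℤ × ℤ × ℤ) × ℤ) :=
  [(-eT γ, s), (eT γ, -s), (-eT μ - eT γ, s), (-eT μ + eT γ, -s),
   (eT ν - eT γ, s), (eT ν + eT γ, -s), (-eT μ + eT ν - eT γ, s), (-eT μ + eT ν + eT γ, -s)]

/-- [folklore] DATA: the offset list of the channel `(μ, ν)`: `ε_{3μγν} ≠ 0` only for `{μ, γ, ν} = {0, 1, 2}`, `γ` the third index, sign = the sign of the permutation `(μ, γ, ν)` of `(0, 1, 2)`;
the six non-empty channels listed explicitly, all others empty. -/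
def kerList (μ ν : Fin 4) : List ((ℤ × ℤ × ℤ × ℤ) × ℤ) :=
  if μ = 0 ∧ ν = 1 then entries8 0 1 2 (-1) else
  if μ = 1 ∧ ν = 0 then entries8 1 0 2 1 else
  if μ = 0 ∧ ν = 2 then entries8 0 2 1 1 else
  if μ = 2 ∧ ν = 0 then entries8 2 0 1 (-1) else
  if μ = 1 ∧ ν = 2 then entries8 1 2 0 (-1) else
  if μ = 2 ∧ ν = 1 then entries8 2 1 0 1 else []

/-- [folklore] DATA: the Ward combination of channel `(μ, ν)` at the level of offsets — the list of `csKernel μ ν (· − e_μ)` (offsets shifted by `e_μ`) followed by that of `−csKernel μ ν`. -/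
def shiftNeg (μ ν : Fin 4) : List ((ℤ × ℤ × ℤ × ℤ) × ℤ) :=
  (kerList μ ν).map (fun p => (p.1 + eT μ, p.2)) ++ (kerList μ ν).map (fun p => (p.1, -p.2))

/-- [folklore] DATA: the full Ward combination `Σ_μ (csKernel μ ν (· − e_μ) − csKernel μ ν)` at the level of offsets. -/
def wardList (ν : Fin 4) : List ((ℤ × ℤ × ℤ × ℤ) × ℤ) := shiftNeg 0 ν ++ shiftNeg 1 ν ++ shiftNeg 2 ν ++ shiftNeg 3 ν

/-- [folklore] DATA: the index-symmetry combination `csKernel μ ν − csKernel ν μ (−·)` at the level of offsets. -/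
def swapList (μ ν : Fin 4) : List ((ℤ × ℤ × ℤ × ℤ) × ℤ) := kerList μ ν ++ ((kerList ν μ).map fun p => (-p.1, p.2)).map (fun p => (p.1, -p.2))

/-- [folklore] **THE WITNESS KERNEL** `csKernel μ ν z = Σ_{(w,c) ∈ kerList μ ν} c·[z = w]` — the lattice form of `ε^{3μγν} A_μ ∂_γ A_ν` smeared by `(1 + T₋ₑμ)(1 + Tₑν)` so that the backward
first-index divergence vanishes exactly; finitely supported (in the box `‖z‖_∞ ≤ 1`, axis `3` idle). -/
def csKernel : B12Beta.Kernel 4 := fun μ ν z => ((kerList μ ν).map fun p => if z = toVec p.1 then (p.2 : ℝ) else 0).sum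

/-- [folklore] The kernel as a delta combination over lattice-vector offsets (the §1 shape). -/
theorem csKernel_eq_deltaSum (μ ν : Fin 4) (z : Fin 4 → ℤ) :
    csKernel μ ν z = (((kerList μ ν).map fun p => (toVec p.1, p.2)).map fun p => if z = p.1 then (p.2 : ℝ) else 0).sum := by
  rw [csKernel, List.map_map]; rfl

/-- [folklore] `toVec` is additive. -/
theorem toVec_add (s t : ℤ × ℤ × ℤ × ℤ) : toVec (s + t) = toVec s + toVec t := by
  funext i; fin_cases i <;> simp [toVec]

/-- [folklore] `toVec` commutes with negation. -/
theorem toVec_neg (t : ℤ × ℤ × ℤ × ℤ) : toVec (-t) = -toVec t := by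
  funext i; fin_cases i <;> simp [toVec]

/-- [folklore] `toVec (eT μ) = e_μ`. -/
theorem toVec_eT (μ : Fin 4) : toVec (eT μ) = unitVec μ := by
  funext i; fin_cases μ <;> fin_cases i <;> simp [toVec, eT, unitVec_apply]

/-- [folklore] Mapping the offsets through `toVec` commutes with the list bookkeeping of §1 (shift by `e_μ`). -/
theorem map_toVec_shift (L : List ((ℤ × ℤ × ℤ × ℤ) × ℤ)) (μ : Fin 4) :
    (L.map fun p => (toVec p.1, p.2)).map (fun p => (p.1 + unitVec μ, p.2)) = (L.map fun p => (p.1 + eT μ, p.2)).map fun p => (toVec p.1, p.2) := by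
  rw [List.map_map, List.map_map]
  refine List.map_congr_left fun p _ => ?_
  simp only [Function.comp_apply, toVec_add, toVec_eT]

/-- [folklore] … (reflection of the offsets). -/
theorem map_toVec_neg (L : List ((ℤ × ℤ × ℤ × ℤ) × ℤ)) :
    (L.map fun p => (toVec p.1, p.2)).map (fun p => (-p.1, p.2)) = (L.map fun p => (-p.1, p.2)).map fun p => (toVec p.1, p.2) := by
  rw [List.map_map, List.map_map]
  refine List.map_congr_left fun p _ => ?_
  simp only [Function.comp_apply, toVec_neg]

/-- [folklore] … (negation of the coefficients). -/
theorem map_toVec_negCoeff (L : List ((ℤ × ℤ × ℤ × ℤ) × ℤ)) :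
    (L.map fun p => (toVec p.1, p.2)).map (fun p => (p.1, -p.2)) = (L.map fun p => (p.1, -p.2)).map fun p => (toVec p.1, p.2) := by
  rw [List.map_map, List.map_map]; rfl

/-- [folklore] `toVec` is injective, so «balanced» can be decided on the quadruples: the filter by lattice-vector offset is the filter by quadruple offset. -/
theorem toVec_injective : Function.Injective toVec := by
  intro s t h
  have h0 : toVec s 0 = toVec t 0 := congrFun h 0
  have h1 : toVec s 1 = toVec t 1 := congrFun h 1
  have h2 : toVec s 2 = toVec t 2 := congrFun h 2
  have h3 : toVec s 3 = toVec t 3 := congrFun h 3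
  simp only [toVec, Fin.isValue, ↓reduceIte, Fin.reduceEq] at h0 h1 h2 h3
  exact Prod.ext h0 (Prod.ext h1 (Prod.ext h2 h3))

/-- [folklore] Balanced on quadruples ⟹ balanced on lattice vectors ⟹ the delta combination vanishes identically. -/
theorem deltaSum_toVec_eq_zero_of_balanced (L : List ((ℤ × ℤ × ℤ × ℤ) × ℤ)) (hbal : ∀ p ∈ L, ((L.filter fun q => decide (q.1 = p.1)).map Prod.snd).sum = 0)
    (z : Fin 4 → ℤ) : ((L.map fun p => (toVec p.1, p.2)).map fun p => if z = p.1 then (p.2 : ℝ) else 0).sum = 0 := by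
  refine deltaSum_eq_zero_of_balanced _ (fun p hp => ?_) z
  obtain ⟨p₀, hp₀, rfl⟩ := List.mem_map.mp hp
  have hfilt : (L.map fun p => (toVec p.1, p.2)).filter (fun q => decide (q.1 = toVec p₀.1)) = (L.filter fun q => decide (q.1 = p₀.1)).map fun p => (toVec p.1, p.2) := by
    rw [List.filter_map]
    congr 1
    refine List.filter_congr fun q _ => ?_
    simp only [Function.comp_apply, toVec_injective.eq_iff]
  rw [show (toVec p₀.1, p₀.2).1 = toVec p₀.1 from rfl, hfilt, List.map_map]
  rw [show Prod.snd ∘ (fun p : (ℤ × ℤ × ℤ × ℤ) × ℤ => (toVec p.1, p.2)) = Prod.snd from rfl]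
  exact hbal p₀ hp₀

/-! ## §3 The printed laws (5.9), (5.8) hold for the witness; its moments are summable; its parity-odd first moment `m₁(0,1,2)` is `8` -/

/-- [folklore] DATA CHECK (`decide`): the Ward combination `wardList ν` is balanced for every `ν` — every offset's coefficients sum to zero. -/
theorem ward_balanced : ∀ ν : Fin 4, ∀ p ∈ wardList ν, (((wardList ν).filter fun q => decide (q.1 = p.1)).map Prod.snd).sum = 0 := by
  decide

/-- [folklore] DATA CHECK (`decide`): the index-symmetry combination `swapList μ ν` is balanced for every `(μ, ν)`. -/
theorem swap_balanced : ∀ μ ν : Fin 4, ∀ p ∈ swapList μ ν, (((swapList μ ν).filter fun q => decide (q.1 = p.1)).map Prod.snd).sum = 0 := by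
  decide

/-- [folklore] **(5.9) FOR THE WITNESS**: `Σ_μ (csKernel μ ν (z − e_μ) − csKernel μ ν z) = 0` for every `ν`, `z` — the backward first-index divergence vanishes identically on `ℤ⁴`. -/
theorem wardTransversal_csKernel : WardTransversal csKernel := by
  intro ν z
  have hsum : ∀ μ : Fin 4, csKernel μ ν (z - unitVec μ) - csKernel μ ν z =
      (((shiftNeg μ ν).map fun p => (toVec p.1, p.2)).map fun p => if z = p.1 then (p.2 : ℝ) else 0).sum := by
    intro μ
    rw [csKernel_eq_deltaSum, csKernel_eq_deltaSum, deltaSum_shift, map_toVec_shift, sub_eq_add_neg, ← deltaSum_negCoeff, map_toVec_negCoeff,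
      shiftNeg, List.map_append, List.map_append, List.sum_append]
  have key := deltaSum_toVec_eq_zero_of_balanced _ (ward_balanced ν) z
  simp only [wardList, List.map_append, List.sum_append] at key
  rw [Fin.sum_univ_four, hsum, hsum, hsum, hsum]
  linarith

/-- [folklore] **(5.8) FOR THE WITNESS**: `csKernel μ ν z = csKernel ν μ (−z)`. -/
theorem indexSymmetric_csKernel : IndexSymmetric csKernel := by
  intro μ ν z
  have key := deltaSum_toVec_eq_zero_of_balanced _ (swap_balanced μ ν) z
  rw [swapList, List.map_append, List.map_append, List.sum_append, ← map_toVec_negCoeff, deltaSum_negCoeff, ← map_toVec_neg, ← deltaSum_neg,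
    ← csKernel_eq_deltaSum, ← csKernel_eq_deltaSum] at key
  linarith

/-- [folklore] Every polynomial moment of the witness is summable (finite support). -/
theorem momentSummable_csKernel (n : ℕ) : MomentSummable csKernel n := fun μ ν => by
  have h := summable_abs_deltaSum_mul ((kerList μ ν).map fun p => (toVec p.1, p.2)) n
  refine h.congr fun z => ?_
  rw [← csKernel_eq_deltaSum]

/-- [folklore] **THE PARITY-ODD FIRST MOMENT OF THE WITNESS**: `m₁(0,1,2) = Σ_z csKernel 0 1 z · z₂ = 8`. -/
theorem firstMoment_csKernel_012 : firstMoment csKernel 0 1 2 = 8 := by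
  unfold OddMoments.firstMoment
  simp_rw [csKernel_eq_deltaSum]
  rw [tsum_deltaSum_mul]
  simp [kerList, entries8, eT, toVec]
  norm_num

/-! ## §4 Sharpness: (5.9) + (5.8) + summable moments do NOT give (T1); the reduced hypothesis and (5.7) fail for the witness -/

/-- [folklore] Not every first moment of the witness vanishes. -/
theorem not_firstMoments_vanish_csKernel : ¬ ∀ μ ν γ : Fin 4, firstMoment csKernel μ ν γ = 0 := fun h => by
  have h8 := firstMoment_csKernel_012
  rw [h 0 1 2] at h8
  norm_num at h8

/-- [folklore] **THE REDUCED HYPOTHESIS OF `Gaps/D1ParityOddFirstMoments` FAILS FOR THE WITNESS** although (5.9), (5.8) and summability hold: the four increasing parity-odd moments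
are genuinely additional data. -/
theorem not_oddFree_csKernel : ¬ ∀ a b c : Fin 4, a < b → b < c → firstMoment csKernel a b c = 0 := fun h => by
  have h8 := firstMoment_csKernel_012
  rw [h 0 1 2 (by decide) (by decide)] at h8
  norm_num at h8

/-- [folklore] The witness is NOT axis-reflection covariant (5.7) (else an1's `firstMoment_eq_zero_of_reflectionCovariant` would kill `m₁(0,1,2)`): (5.9) + (5.8) do not imply (5.7). -/
theorem not_axisReflectionCovariant_csKernel : ¬ AxisReflectionCovariant csKernel := fun hR =>
  not_firstMoments_vanish_csKernel fun μ ν γ => firstMoment_eq_zero_of_reflectionCovariant hR μ ν γ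

/-- [folklore] **SHARPNESS OF THE REDUCTION, AS AN EXISTENCE STATEMENT**: there is a kernel on `ℤ⁴` obeying the Ward identity (5.9) and the index symmetry (5.8), with every polynomial
moment summable, whose first moments do NOT all vanish — the socket's (T1) is not a consequence of `hW` + (5.8) + decay. -/
theorem exists_ward_indexSymmetric_not_T1 :
    ∃ P : B12Beta.Kernel 4, WardTransversal P ∧ IndexSymmetric P ∧ (∀ n, MomentSummable P n) ∧ ¬ ∀ μ ν γ : Fin 4, firstMoment P μ ν γ = 0 :=
  ⟨csKernel, wardTransversal_csKernel, indexSymmetric_csKernel, momentSummable_csKernel, not_firstMoments_vanish_csKernel⟩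

end Summit.QuantumFields.BalabanUV.Gaps.D1ParityOddWitness

end
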